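import Literature.NumberTheory.LFunctions.ClassGroupExplicitFormula
import Literature.NumberTheory.LFunctions.DedekindZetaExplicitFormula
import Literature.NumberTheory.LFunctions.ThornerZamanWeight
import Literature.NumberTheory.LFunctions.ExplicitFormulaPsiOne
import HarnessLib

/-!
# Bounds for the secondary terms of the explicit formula against the Thorner–Zaman weight

Topic `Literature/NumberTheory/LFunctions`, namespace `Literature.NumberTheory.LFunctions.NumberField`.
Everything here is PROVED (theorems only; `leftLineConst` is an explicit absolute constant).

For the weight `g = tzTest L ε` (`L = log x`, `0 < ε < L/2`) the explicit formulae
`coefFordK_eq_explicit` (`χ ≠ 1`) and `coefFordK_one_eq_explicit` (`ζ_K`) at `s = 0` carry, besides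
the zero sum, the terms `m₀ F(0)` and the left-line integrals `J_χ(0)`, `J₁(0)`.  Here:

* `norm_fordLaplace_tzTest_zero_le` — `‖F(0)‖ ≤ L + ε`;
* `norm_cgEFRemainder_tzTest_zero_le`, `norm_dzEFRemainder_tzTest_zero_le` —
  `‖J(0)‖ ≤ leftLineConst · A (n_K + 1) · (log|d_K| + log 4 + 1) · e^{−L/4 + ε/2} · (2M/ε)`
  (`|L'/L(−1/2 + iy)| ≤ A(n_K+1)(log|d_K| + log(|y| + 4))` of `exists_norm_logDeriv_classGroupLFunction_left_le`
  against `‖F(1/2 − iy)‖ ≤ e^{−L/4+ε/2} (2M/ε)/(1/4 + y²)` of `TZWeight.norm_fordLaplace_tzTest_le`);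
* `analyticOrderNatAt_classGroupLFunction₀_zero_le`, `analyticOrderNatAt_dedekindZeta₁_zero_le` —
  `m₀ ≤ 8 (log|d_K| + 7 n_K + 4)` (Jensen in `|s − 3/2| ≤ 7/4 ⊂ |s − 3/2| ≤ 2`, convexity bound of `Z₁`).

## References

* J. Thorner, A. Zaman, ANT 13 (2019), Lemma 4.3, §4.3. [ThornerZaman2019]
-/

noncomputable section

open Complex Real MeasureTheory Set Filter Topology Metric
open scoped NumberField

namespace Literature.NumberTheory.LFunctions.NumberField

open Literature.NumberTheory.LFunctions.TZWeight Literature.NumberTheory.LFunctions.EntireEF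

variable {K : Type} [Field K] [NumberField K]

/-! ### `F(0)` -/

/-- `‖F(0)‖ ≤ L + ε` for the TZ weight. [folklore] -/
theorem norm_fordLaplace_tzTest_zero_le {L ε : ℝ} (hL : 0 < L) (hε : 0 < ε) (hεL : ε < L / 2) :
    ‖fordLaplace (tzTest L ε) 0‖ ≤ L + ε := by
  have h := norm_fordLaplace_tzTest_le₀ hL hε hεL 0
  rw [edgeExp] at h
  simpa using h

/-! ### The left-line integrals -/

/-- The absolute constant `(1/2π) ∫ (1 + 2 log(1 + |u|))/(1/4 + u²) du`. [folklore] -/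
def leftLineConst : ℝ := 1 / (2 * π) * ∫ u : ℝ, (1 + 2 * Real.log (1 + |u|)) / (1 / 4 + u ^ 2)

/-- `0 ≤ leftLineConst`. [folklore] -/
theorem leftLineConst_nonneg : 0 ≤ leftLineConst := by
  rw [leftLineConst]
  refine mul_nonneg (by positivity) (integral_nonneg fun u ↦ ?_)
  have : 0 ≤ Real.log (1 + |u|) := Real.log_nonneg (by linarith [abs_nonneg u])
  positivity

/-- The common estimate: if `‖Φ(y)‖ ≤ B (A₀ + 2 log(1 + |y|))` with `A₀ ≥ 1` and
`‖Ψ(y)‖ ≤ E/(1/4 + y²)`, then `(1/2π)‖∫ Φ Ψ‖ ≤ leftLineConst · B · A₀ · E` (for an integrable product).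
[folklore] -/
theorem norm_leftLine_integral_le {Φ Ψ : ℝ → ℂ} {B A₀ E : ℝ} (hB : 0 ≤ B) (hA₀ : 1 ≤ A₀) (hE : 0 ≤ E)
    (hΦ : ∀ y, ‖Φ y‖ ≤ B * (A₀ + 2 * Real.log (1 + |y|))) (hΨ : ∀ y, ‖Ψ y‖ ≤ E / (1 / 4 + y ^ 2))
    (hmeas : AEStronglyMeasurable (fun y ↦ Φ y * Ψ y) volume) :
    ‖(1 / (2 * π) : ℂ) * ∫ y : ℝ, Φ y * Ψ y‖ ≤ leftLineConst * B * A₀ * E := by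
  have hKint := PsiOneExplicit.integrable_left_majorant (A := 1) zero_le_one
  set g : ℝ → ℝ := fun y ↦ B * A₀ * E * ((1 + 2 * Real.log (1 + |y|)) / (1 / 4 + y ^ 2)) with hg
  have hgint : Integrable g := hKint.const_mul _
  have hptw : ∀ y, ‖Φ y * Ψ y‖ ≤ g y := by
    intro y
    have hl0 : 0 ≤ Real.log (1 + |y|) := Real.log_nonneg (by linarith [abs_nonneg y])
    have hnum : A₀ + 2 * Real.log (1 + |y|) ≤ A₀ * (1 + 2 * Real.log (1 + |y|)) := by nlinarith
    rw [norm_mul, hg]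
    calc ‖Φ y‖ * ‖Ψ y‖ ≤ (B * (A₀ + 2 * Real.log (1 + |y|))) * (E / (1 / 4 + y ^ 2)) :=
          mul_le_mul (hΦ y) (hΨ y) (norm_nonneg _) (by positivity)
      _ ≤ (B * (A₀ * (1 + 2 * Real.log (1 + |y|)))) * (E / (1 / 4 + y ^ 2)) :=
          mul_le_mul_of_nonneg_right (mul_le_mul_of_nonneg_left hnum hB) (by positivity)
      _ = _ := by ring
  have hint : Integrable fun y ↦ Φ y * Ψ y := hgint.mono' hmeas (ae_of_all _ hptw)
  have hI : ‖∫ y : ℝ, Φ y * Ψ y‖ ≤ B * A₀ * E * ∫ u : ℝ, (1 + 2 * Real.log (1 + |u|)) / (1 / 4 + u ^ 2) := by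
    refine (norm_integral_le_of_norm_le hgint (ae_of_all _ hptw)).trans_eq ?_
    rw [hg, integral_const_mul]
  rw [norm_mul]
  have hπ : ‖(1 / (2 * π) : ℂ)‖ = 1 / (2 * π) := by
    rw [show (1 / (2 * π) : ℂ) = ((1 / (2 * π) : ℝ) : ℂ) by push_cast; ring, Complex.norm_real,
      Real.norm_eq_abs, abs_of_pos (by positivity)]
  rw [hπ, leftLineConst]
  calc 1 / (2 * π) * ‖∫ y : ℝ, Φ y * Ψ y‖ ≤ 1 / (2 * π) * (B * A₀ * E * ∫ u : ℝ, (1 + 2 * Real.log (1 + |u|)) / (1 / 4 + u ^ 2)) :=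
        mul_le_mul_of_nonneg_left hI (by positivity)
    _ = _ := by ring

/-- `‖F(0 − (−1/2 + iy))‖ = ‖F(1/2 − iy)‖ ≤ e^{−L/4 + ε/2} (2M/ε)/(1/4 + y²)` for the TZ weight. [folklore] -/
theorem norm_fordLaplace_tzTest_leftLine_le {M : ℝ}
    (hM : ∀ y : ℝ, |iteratedDeriv 1 Real.smoothTransition y| ≤ M ∧ |iteratedDeriv 2 Real.smoothTransition y| ≤ M)
    {L ε : ℝ} (hL : 0 < L) (hε : 0 < ε) (hεL : ε < L / 2) (y : ℝ) :
    ‖fordLaplace₀ (tzTest L ε) (0 - (((-(1 / 2) : ℝ) : ℂ) + y * I))‖ ≤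
      (Real.exp (-(L / 4) + ε / 2) * (2 * M / ε)) / (1 / 4 + y ^ 2) := by
  set w : ℂ := 0 - (((-(1 / 2) : ℝ) : ℂ) + y * I) with hw
  have hwre : w.re = 1 / 2 := by simp [hw]
  have hwim : w.im = -y := by simp [hw]
  have hw0 : w ≠ 0 := fun h ↦ by have := congrArg Complex.re h; rw [hwre] at this; norm_num at this
  rw [fordLaplace₀_eq_fordLaplace (tzTest_zero hL hε hεL.le)]
  have h := (norm_fordLaplace_tzTest_le hM hL hε hεL hw0).2
  have hE : edgeExp L ε w = Real.exp (-(L / 4) + ε / 2) := by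
    rw [edgeExp, hwre]
    have h1 : -(1 / 2 * (L / 2 - ε)) = -(L / 4) + ε / 2 := by ring
    have h2 : -(1 / 2 * (L + ε)) ≤ -(L / 4) + ε / 2 := by linarith
    rw [h1]; exact max_eq_left (Real.exp_le_exp.2 h2)
  have hnorm : ‖w‖ ^ 2 = 1 / 4 + y ^ 2 := by
    rw [Complex.sq_norm, Complex.normSq_apply, hwre, hwim]; ring
  rw [hE, hnorm] at h
  exact h

/-- **`‖J_χ(0)‖ ≤ leftLineConst · A(n_K+1) · (log|d_K| + log 4 + 1) · e^{−L/4+ε/2} (2M/ε)`** for `χ ≠ 1` and the TZ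
weight, with the constant `A` of `exists_norm_logDeriv_classGroupLFunction_left_le`. [cite: ThornerZaman2019, Lemma 4.3] -/
theorem norm_cgEFRemainder_tzTest_zero_le {A : ℝ} (hA0 : 0 < A)
    (hA : ∀ (K : Type) [Field K] [NumberField K] (χ : ClassGroup (𝓞 K) →* ℂˣ) (t : ℝ),
      ‖logDeriv (classGroupLFunction K χ) (-1 / 2 + t * I)‖ ≤
        A * (Module.finrank ℚ K + 1) * (Real.log ((NumberField.discr K).natAbs : ℝ) + Real.log (|t| + 4)))
    {χ : ClassGroup (𝓞 K) →* ℂˣ} (hχ : χ ≠ 1) {M : ℝ}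
    (hM : ∀ y : ℝ, |iteratedDeriv 1 Real.smoothTransition y| ≤ M ∧ |iteratedDeriv 2 Real.smoothTransition y| ≤ M)
    {L ε : ℝ} (hL : 0 < L) (hε : 0 < ε) (hεL : ε < L / 2) :
    ‖cgEFRemainder χ (tzTest L ε) 0‖ ≤
      leftLineConst * (A * (Module.finrank ℚ K + 1)) * (Real.log ((NumberField.discr K).natAbs : ℝ) + Real.log 4 + 1) *
        (Real.exp (-(L / 4) + ε / 2) * (2 * M / ε)) := by
  have hM0 : 0 ≤ M := le_trans (abs_nonneg _) (hM 0).1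
  rw [cgEFRemainder]
  simp_rw [cgEFIntegrand]
  refine norm_leftLine_integral_le (by positivity) ?_ (by positivity) (fun y ↦ ?_)
    (fun y ↦ norm_fordLaplace_tzTest_leftLine_le hM hL hε hεL y) ?_
  · have : 0 ≤ Real.log ((NumberField.discr K).natAbs : ℝ) := Real.log_natCast_nonneg _
    have : 0 ≤ Real.log 4 := Real.log_nonneg (by norm_num)
    linarith
  · rw [norm_neg, (classGroupLFunction₀_leftLine_ne_zero hχ y).2]
    refine (hA K χ y).trans ?_
    have hlog4 : Real.log (|y| + 4) ≤ Real.log 4 + Real.log (1 + |y|) := by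
      rw [← Real.log_mul (by norm_num) (by linarith [abs_nonneg y])]
      exact Real.log_le_log (by linarith [abs_nonneg y]) (by nlinarith [abs_nonneg y])
    have hl1 : 0 ≤ Real.log (1 + |y|) := Real.log_nonneg (by linarith [abs_nonneg y])
    refine mul_le_mul_of_nonneg_left ?_ (by positivity)
    linarith
  · have hcont := continuous_cgIntegrand_left hχ ((tzTest_contDiff L ε 0).continuous) (by linarith : (0:ℝ) ≤ L + ε)
      (isSmoothedEFTest_tzTest hL hε).eq_zero (tzTest_zero hL hε hεL.le) 0
    simp_rw [cgEFIntegrand] at hcont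
    exact hcont.aestronglyMeasurable

/-- **`‖J₁(0)‖ ≤ leftLineConst · A(n_K+1) · (log|d_K| + log 4 + 1) · e^{−L/4+ε/2} (2M/ε)`** for `ζ_K`. [cite: ThornerZaman2019, Lemma 4.3] -/
theorem norm_dzEFRemainder_tzTest_zero_le {A : ℝ} (hA0 : 0 < A)
    (hA : ∀ (K : Type) [Field K] [NumberField K] (χ : ClassGroup (𝓞 K) →* ℂˣ) (t : ℝ),
      ‖logDeriv (classGroupLFunction K χ) (-1 / 2 + t * I)‖ ≤
        A * (Module.finrank ℚ K + 1) * (Real.log ((NumberField.discr K).natAbs : ℝ) + Real.log (|t| + 4)))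
    {M : ℝ} (hM : ∀ y : ℝ, |iteratedDeriv 1 Real.smoothTransition y| ≤ M ∧ |iteratedDeriv 2 Real.smoothTransition y| ≤ M)
    {L ε : ℝ} (hL : 0 < L) (hε : 0 < ε) (hεL : ε < L / 2) :
    ‖dzEFRemainder K (tzTest L ε) 0‖ ≤
      leftLineConst * (A * (Module.finrank ℚ K + 1)) * (Real.log ((NumberField.discr K).natAbs : ℝ) + Real.log 4 + 1) *
        (Real.exp (-(L / 4) + ε / 2) * (2 * M / ε)) := by
  have hM0 : 0 ≤ M := le_trans (abs_nonneg _) (hM 0).1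
  rw [dzEFRemainder]
  simp_rw [dzEFIntegrand]
  refine norm_leftLine_integral_le (by positivity) ?_ (by positivity) (fun y ↦ ?_)
    (fun y ↦ norm_fordLaplace_tzTest_leftLine_le hM hL hε hεL y) ?_
  · have : 0 ≤ Real.log ((NumberField.discr K).natAbs : ℝ) := Real.log_natCast_nonneg _
    have : 0 ≤ Real.log 4 := Real.log_nonneg (by norm_num)
    linarith
  · rw [norm_neg, (classGroupLFunction_one_leftLine_ne_zero (K := K) y).2.2]
    refine (hA K 1 y).trans ?_
    have hlog4 : Real.log (|y| + 4) ≤ Real.log 4 + Real.log (1 + |y|) := by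
      rw [← Real.log_mul (by norm_num) (by linarith [abs_nonneg y])]
      exact Real.log_le_log (by linarith [abs_nonneg y]) (by nlinarith [abs_nonneg y])
    have hl1 : 0 ≤ Real.log (1 + |y|) := Real.log_nonneg (by linarith [abs_nonneg y])
    refine mul_le_mul_of_nonneg_left ?_ (by positivity)
    linarith
  · have hcont := continuous_dzIntegrand_left (K := K) ((tzTest_contDiff L ε 0).continuous) (by linarith : (0:ℝ) ≤ L + ε)
      (isSmoothedEFTest_tzTest hL hε).eq_zero (tzTest_zero hL hε hεL.le) 0
    simp_rw [dzEFIntegrand] at hcont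
    exact hcont.aestronglyMeasurable


/-! ### The order of vanishing at `0` -/

/-- **Jensen at the centre `3/2`**: for an entire `f` with `‖f z‖ ≤ B` on `|z − 3/2| = 2` (`B ≥ 1`) and
`‖f(3/2)‖ ≥ e^{−b}` (`b ≥ 0`), `ord₀ f ≤ 8 (log B + b)` (`0` lies in `|z − 3/2| ≤ 7/4`, `log(8/7) ≥ 1/8`). [folklore] -/
theorem analyticOrderNatAt_zero_le_of_bounds {f : ℂ → ℂ} (hf : Differentiable ℂ f) {B b : ℝ} (hB : 1 ≤ B) (hb : 0 ≤ b)
    (hbound : ∀ z ∈ sphere ((3 / 2 : ℝ) : ℂ) 2, ‖f z‖ ≤ B) (hlow : Real.exp (-b) ≤ ‖f ((3 / 2 : ℝ) : ℂ)‖) :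
    (analyticOrderNatAt f 0 : ℝ) ≤ 8 * (Real.log B + b) := by
  set c : ℂ := ((3 / 2 : ℝ) : ℂ) with hc
  have hc0 : f c ≠ 0 := by
    intro h; rw [h, norm_zero] at hlow; linarith [Real.exp_pos (-b)]
  have h1 : 0 < |(7 / 4 : ℝ)| := by norm_num
  have h2 : |(7 / 4 : ℝ)| < |(2 : ℝ)| := by norm_num
  have h3 : AnalyticOnNhd ℂ f (closedBall c |(2 : ℝ)|) := fun z _ ↦ hf.analyticAt z
  have h4 : ∀ z ∈ sphere c |(2 : ℝ)|, ‖f z‖ ≤ B := by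
    intro z hz; rw [abs_of_pos two_pos] at hz; exact hbound z hz
  have hJ := AnalyticOnNhd.sum_divisor_le h1 h2 hB h3 hc0 h4
  rw [abs_of_pos (by norm_num : (0:ℝ) < 7 / 4)] at hJ
  set D := MeromorphicOn.divisor f (closedBall c (7 / 4)) with hD
  have hfin : (Function.support D).Finite := D.finiteSupport (isCompact_closedBall _ _)
  have hDnn : ∀ u, 0 ≤ D u := fun u ↦ MeromorphicOn.AnalyticOnNhd.divisor_nonneg (fun z _ ↦ hf.analyticAt z) u
  -- the divisor at `0` is the order of vanishing
  have h0mem : (0 : ℂ) ∈ closedBall c (7 / 4) := by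
    rw [mem_closedBall, dist_eq_norm, hc, zero_sub, norm_neg, Complex.norm_real]; norm_num
  have hne : analyticOrderAt f 0 ≠ ⊤ := by
    intro htop
    have h0 : f =ᶠ[𝓝 (0:ℂ)] 0 := analyticOrderAt_eq_top.mp htop
    have hall : AnalyticOnNhd ℂ f univ := fun z _ ↦ hf.analyticAt z
    exact hc0 (hall.eqOn_zero_of_preconnected_of_eventuallyEq_zero isPreconnected_univ (mem_univ 0) h0 (mem_univ c))
  have hD0 : D 0 = (analyticOrderNatAt f 0 : ℤ) := by
    rw [hD, MeromorphicOn.divisor_apply (fun z _ ↦ (hf.analyticAt z).meromorphicAt) h0mem,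
      (hf.analyticAt 0).meromorphicOrderAt_eq, ← Nat.cast_analyticOrderNatAt hne]
    simp
  -- `m₀ ≤ Σᶠ D`
  have hle : (analyticOrderNatAt f 0 : ℤ) ≤ ∑ᶠ u, D u := by
    rw [← hD0, finsum_eq_sum_of_support_subset D (s := hfin.toFinset) (by intro u hu; simpa using hu)]
    by_cases h00 : D 0 = 0
    · rw [h00]; exact Finset.sum_nonneg fun u _ ↦ hDnn u
    · exact Finset.single_le_sum (fun u _ ↦ hDnn u) (by simpa using h00)
  have hcast : ((analyticOrderNatAt f 0 : ℤ) : ℝ) ≤ ((∑ᶠ u, D u : ℤ) : ℝ) := by exact_mod_cast hle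
  have hlog87 : 1 / 8 ≤ Real.log (2 / (7 / 4)) := by
    have := Real.one_sub_inv_le_log_of_pos (x := 2 / (7 / 4)) (by norm_num)
    norm_num at this ⊢; linarith
  have hnum : Real.log (B / ‖f c‖) ≤ Real.log B + b := by
    have hfc : 0 < ‖f c‖ := norm_pos_iff.2 hc0
    rw [Real.log_div (by linarith) hfc.ne']
    have : -b ≤ Real.log ‖f c‖ := by
      have := Real.log_le_log (Real.exp_pos _) hlow
      rwa [Real.log_exp] at this
    linarith
  have hnum0 : 0 ≤ Real.log B + b := by have := Real.log_nonneg hB; positivity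
  calc (analyticOrderNatAt f 0 : ℝ) = ((analyticOrderNatAt f 0 : ℤ) : ℝ) := by norm_cast
    _ ≤ ((∑ᶠ u, D u : ℤ) : ℝ) := hcast
    _ ≤ Real.log (B / ‖f c‖) / Real.log (2 / (7 / 4)) := hJ
    _ ≤ (Real.log B + b) / (1 / 8) := by
        calc Real.log (B / ‖f c‖) / Real.log (2 / (7 / 4)) ≤ (Real.log B + b) / Real.log (2 / (7 / 4)) :=
              div_le_div_of_nonneg_right hnum (by linarith)
          _ ≤ (Real.log B + b) / (1 / 8) := div_le_div_of_nonneg_left hnum0 (by norm_num) hlog87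
    _ = 8 * (Real.log B + b) := by ring

/-- On `|z − 3/2| = 2`: `Re z ≥ −1/2`, `‖z + 5/2‖ ≤ 6`, `‖z − 1‖ ≥ 3/2`. [folklore] -/
theorem sphere_three_halves_facts {z : ℂ} (hz : z ∈ sphere ((3 / 2 : ℝ) : ℂ) 2) :
    -1 / 2 ≤ z.re ∧ ‖z + 5 / 2‖ ≤ 6 ∧ 3 / 2 ≤ ‖z - 1‖ := by
  rw [mem_sphere, dist_eq_norm] at hz
  have hre : |z.re - 3 / 2| ≤ 2 := by
    have h := abs_re_le_norm (z - ((3 / 2 : ℝ) : ℂ))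
    rw [hz] at h
    simpa using h
  refine ⟨by linarith [abs_le.1 hre], ?_, ?_⟩
  · calc ‖z + 5 / 2‖ = ‖(z - ((3 / 2 : ℝ) : ℂ)) + 4‖ := by congr 1; push_cast; ring
      _ ≤ ‖z - ((3 / 2 : ℝ) : ℂ)‖ + ‖(4 : ℂ)‖ := norm_add_le _ _
      _ = 6 := by rw [hz]; norm_num
  · have : ‖z - ((3 / 2 : ℝ) : ℂ)‖ ≤ ‖z - 1‖ + ‖(1 : ℂ) - ((3 / 2 : ℝ) : ℂ)‖ := by
      calc ‖z - ((3 / 2 : ℝ) : ℂ)‖ = ‖(z - 1) + ((1 : ℂ) - ((3 / 2 : ℝ) : ℂ))‖ := by congr 1; ring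
        _ ≤ _ := norm_add_le _ _
    have h12 : ‖(1 : ℂ) - ((3 / 2 : ℝ) : ℂ)‖ = 1 / 2 := by
      rw [show (1 : ℂ) - ((3 / 2 : ℝ) : ℂ) = ((-(1 / 2) : ℝ) : ℂ) by push_cast; ring, Complex.norm_real]; norm_num
    rw [hz, h12] at this; linarith

/-- `log(|d| e^{2n} 6^{n+1}) ≤ log|d| + 4n + 2` and the bound is `≥ 1`. [folklore] -/
theorem convexityDiscBound_facts (K : Type) [Field K] [NumberField K] :
    1 ≤ ((NumberField.discr K).natAbs : ℝ) * Real.exp (2 * Module.finrank ℚ K) * (6 : ℝ) ^ (Module.finrank ℚ K + 1) ∧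
      Real.log (((NumberField.discr K).natAbs : ℝ) * Real.exp (2 * Module.finrank ℚ K) * (6 : ℝ) ^ (Module.finrank ℚ K + 1)) ≤
        Real.log ((NumberField.discr K).natAbs : ℝ) + 4 * Module.finrank ℚ K + 2 := by
  set n : ℕ := Module.finrank ℚ K
  have hd1 : (1 : ℝ) ≤ ((NumberField.discr K).natAbs : ℝ) := by
    exact_mod_cast Nat.one_le_iff_ne_zero.2 (Int.natAbs_ne_zero.2 (NumberField.discr_ne_zero K))
  have hE : (1 : ℝ) ≤ Real.exp (2 * n) := Real.one_le_exp (by positivity)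
  have h6 : (1 : ℝ) ≤ (6 : ℝ) ^ (n + 1) := one_le_pow₀ (by norm_num)
  refine ⟨?_, ?_⟩
  · calc (1 : ℝ) = 1 * 1 * 1 := by ring
      _ ≤ _ := by gcongr
  · rw [Real.log_mul (by positivity) (by positivity), Real.log_mul (by positivity) (by positivity), Real.log_exp, Real.log_pow]
    have hlog6 : Real.log 6 ≤ 2 := by
      rw [Real.log_le_iff_le_exp (by norm_num)]
      have := Real.exp_one_gt_d9
      have h : Real.exp 2 = Real.exp 1 * Real.exp 1 := by rw [← Real.exp_add]; norm_num
      rw [h]; nlinarith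
    have : ((n + 1 : ℕ) : ℝ) * Real.log 6 ≤ 2 * n + 2 := by push_cast; nlinarith
    linarith

/-- **`ord₀ L₀(·, χ) ≤ 8 (log|d_K| + 6 n_K + 2)`** for `χ ≠ 1` (Jensen in `|s − 3/2| ≤ 7/4`; on `|s − 3/2| = 2`,
`‖L₀‖ = ‖Z₁_χ‖/‖s − 1‖ ≤ |d_K| e^{2n} 6^{n+1}`; `‖L₀(3/2)‖ = ‖L(3/2, χ)‖ ≥ e^{−2n}`). [cite: ThornerZaman2019, Lemma 2.5] -/
theorem analyticOrderNatAt_classGroupLFunction₀_zero_le {χ : ClassGroup (𝓞 K) →* ℂˣ} (hχ : χ ≠ 1) :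
    (analyticOrderNatAt (classGroupLFunction₀ K χ) 0 : ℝ) ≤
      8 * (Real.log ((NumberField.discr K).natAbs : ℝ) + 6 * Module.finrank ℚ K + 2) := by
  obtain ⟨hB1, hlogB⟩ := convexityDiscBound_facts K
  set n : ℕ := Module.finrank ℚ K with hn
  have h32 : ((3 / 2 : ℝ) : ℂ) ≠ 1 := by
    intro h; have := congrArg Complex.re h; simp at this; norm_num at this
  have key := analyticOrderNatAt_zero_le_of_bounds (differentiable_classGroupLFunction₀ χ) hB1
    (by positivity : (0:ℝ) ≤ 2 * n) (fun z hz ↦ ?_) ?_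
  · refine key.trans ?_
    have : Real.log (((NumberField.discr K).natAbs : ℝ) * Real.exp (2 * n) * 6 ^ (n + 1)) + 2 * n ≤
        Real.log ((NumberField.discr K).natAbs : ℝ) + 6 * n + 2 := by linarith
    linarith
  · obtain ⟨hre, h6, h1⟩ := sphere_three_halves_facts hz
    have hz1 : z ≠ 1 := by intro h; rw [h, sub_self, norm_zero] at h1; norm_num at h1
    rw [classGroupLFunction₀_eq_div hχ hz1, norm_div]
    have hZ := norm_classTwistedZeta₁_le (K := K) (a := fun C ↦ (χ C : ℂ)) (fun C ↦ (norm_classGroupChar_apply χ C).le) hre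
    have hpow : ‖z + 5 / 2‖ ^ (n + 1) ≤ (6 : ℝ) ^ (n + 1) := pow_le_pow_left₀ (norm_nonneg _) h6 _
    have hd0 : 0 ≤ ((NumberField.discr K).natAbs : ℝ) * Real.exp (2 * n) := by positivity
    calc ‖classTwistedZeta₁ K (fun C ↦ (χ C : ℂ)) z‖ / ‖z - 1‖
        ≤ (((NumberField.discr K).natAbs : ℝ) * Real.exp (2 * n) * ‖z + 5 / 2‖ ^ (n + 1)) / (3 / 2) := by
          refine div_le_div₀ (by positivity) hZ (by norm_num) h1
      _ ≤ (((NumberField.discr K).natAbs : ℝ) * Real.exp (2 * n) * 6 ^ (n + 1)) / 1 := by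
          refine div_le_div₀ (by positivity) (mul_le_mul_of_nonneg_left hpow hd0) one_pos (by norm_num)
      _ = _ := div_one _
  · rw [classGroupLFunction₀_eq χ h32 hχ]
    have h := exp_neg_finrank_div_le_norm_classGroupLFunction (K := K) χ (s := ((3 / 2 : ℝ) : ℂ)) (by simp; norm_num)
    have hre : (((3 / 2 : ℝ) : ℂ)).re - 1 = 1 / 2 := by simp; norm_num
    rw [hre] at h
    refine le_trans (le_of_eq ?_) h
    congr 1; rw [hn]; ring

/-- **`ord₀ ζ₁_K ≤ 8 (log|d_K| + 6 n_K + 3)`** (same Jensen disc; `‖ζ₁_K(3/2)‖ = ζ_K(3/2)/2 ≥ e^{−2n}/2`). [cite: ThornerZaman2019, Lemma 2.5] -/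
theorem analyticOrderNatAt_dedekindZeta₁_zero_le :
    (analyticOrderNatAt (dedekindZeta₁ K) 0 : ℝ) ≤
      8 * (Real.log ((NumberField.discr K).natAbs : ℝ) + 6 * Module.finrank ℚ K + 3) := by
  obtain ⟨hB1, hlogB⟩ := convexityDiscBound_facts K
  set n : ℕ := Module.finrank ℚ K with hn
  have key := analyticOrderNatAt_zero_le_of_bounds (dedekindZeta₁_differentiable K) hB1
    (by positivity : (0:ℝ) ≤ 2 * n + 1) (fun z hz ↦ ?_) ?_
  · refine key.trans ?_
    linarith
  · obtain ⟨hre, h6, -⟩ := sphere_three_halves_facts hz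
    have hZ := norm_dedekindZeta₁_le (K := K) hre
    have hpow : ‖z + 5 / 2‖ ^ (n + 1) ≤ (6 : ℝ) ^ (n + 1) := pow_le_pow_left₀ (norm_nonneg _) h6 _
    have hd0 : 0 ≤ ((NumberField.discr K).natAbs : ℝ) * Real.exp (2 * n) := by positivity
    exact hZ.trans (mul_le_mul_of_nonneg_left hpow hd0)
  · have h32re : (1 : ℝ) < (((3 / 2 : ℝ) : ℂ)).re := by simp; norm_num
    rw [dedekindZeta₁_apply_eq_mul h32re, norm_mul]
    have hζ := NumberField.exp_neg_finrank_div_le_norm_dedekindZeta K h32re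
    have hre : (((3 / 2 : ℝ) : ℂ)).re - 1 = 1 / 2 := by simp; norm_num
    rw [hre] at hζ
    have h12 : ‖((3 / 2 : ℝ) : ℂ) - 1‖ = 1 / 2 := by
      rw [show ((3 / 2 : ℝ) : ℂ) - 1 = ((1 / 2 : ℝ) : ℂ) by push_cast; ring, Complex.norm_real]; norm_num
    rw [h12]
    have hdiv : (n : ℝ) / (1 / 2) = 2 * n := by ring
    rw [hdiv] at hζ
    -- `e^{-(2n+1)} ≤ (1/2) e^{-2n}`
    have hhalf : Real.exp (-(2 * (n : ℝ) + 1)) ≤ 1 / 2 * Real.exp (-(2 * (n : ℝ))) := by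
      rw [show -(2 * (n : ℝ) + 1) = -(2 * (n : ℝ)) + (-1) by ring, Real.exp_add, mul_comm]
      refine mul_le_mul_of_nonneg_right ?_ (Real.exp_pos _).le
      have := Real.exp_one_gt_d9
      rw [Real.exp_neg]
      rw [inv_le_comm₀ (Real.exp_pos 1) (by norm_num)]; linarith
    exact hhalf.trans (mul_le_mul_of_nonneg_left hζ (by norm_num))

end Literature.NumberTheory.LFunctions.NumberField

end
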